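import Literature.NumberTheory.EllipticCurves.LocalWeilPairingDuality
import Literature.NumberTheory.GaloisRepresentations.ContinuousCohomologyConnecting
import Literature.NumberTheory.GaloisRepresentations.LocalGlobalCohomologyTateProofs
import HarnessLib

/-!
# The rational `p`-torsion line `⟨T⟩ ≤ E[p]` and its isotropic plane `W_T = ι_* H¹(F, ⟨T⟩)` in
# `H¹(F, E[p])` — binder (iii) of the three-Lagrangian lemma as THEOREMS of the tree, I: the short
# exact sequence, the cocycle description, isotropy, transport
# (cell `b2b-bsdres`, team n1011, seat p12 GEN 11 — TOOL file; row T-K43-COH, FILE 1a;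
# skeleton `cells/n1011/skel/T-K43-COH.md`)

HONEST FRAMING (cell `b2b-bsdres`, run/shared/lean/b2b/bsd-rank1-residual/, verbatim in every
file): the goal of the cell is to DELETE the COMBINATION-SHAPED residual classes of the
Birch–Swinnerton-Dyer formula for ALL analytic-rank `≤ 1` elliptic curves over `ℚ` — "full BSD
formula for every rank `≤ 1` curve in class `C`" assembled STRICTLY from published theorems — so
that the rank-`≤ 1` remainder becomes exactly the CONSTRUCTION-SHAPED classes, which are TYPED
(missing-input `Prop`s), NOT attempted. This is not "finishing BSD". Team n1011 (N10 / N11, the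
additive block `X4 ∧ p = 3`): research route on a CONSTRUCTION-SHAPED class; no claim beyond the
stated classes; labels UNCHANGED; nothing is booked; census output = EVIDENCE, never a Literature
fact. TOOL THEOREMS ONLY: no definition, no named fact; the cohomological input below (the long
exact sequence of `ContinuousCohomologyConnecting`) is a THEOREM of the tree.

## What (r1 ROUTE-1 §43.1 (iii); p02's T-K43-TOOL F3 binder `hW`)

`K` a number field, `E = W` an elliptic curve over `K`, `p` a prime, `e` a Weil pairing on `E[p]`
(`hμ hadd₁ hadd₂ halt hnondeg hgal`, the tree's `exists_weilPairing_holds`), `F` a `K`-field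
(`F = K_v` in FILE 1b `RationalTorsionLinePlaneCount`), `Γ_F` acting on `E[p](K̄)` through
`absGaloisRestrict K F`, and `T ∈ E[p](K̄)` a NON-ZERO point FIXED by `Γ_F` (a generator of the
rational line `E(K_v)[p]` when `#E(K_v)[p] = p`, "`t_v = p`"). Write `P` for the tree's local
Weil cup-product pairing `(weilContPairing W p e …).restrict (absGaloisRestrict K F)` and

  `g_T := P.rightHom T _ : E[p]|_{Γ_F} ⟶ μ_p|_{Γ_F}`, `S ↦ e(S, T)`   (INLINE, no definition),

the morphism of discrete `Γ_F`-modules "pair with `T`"; its kernel on `H¹` is the plane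

  `W_T := ker (H¹(g_T) : H¹(F, E[p]) → H¹(F, μ_p))`.

* §1 pairing algebra: `e` vanishes on `⟨T⟩ × ⟨T⟩`, `#ℤT = p`, and `ker e(·, T) = ⟨T⟩`,
  `e(·, T)` ONTO `μ_p` (`ker_weilPairingHom_flip_eq_and_surjective`, by counting: `#E[p] = p²`,
  `#μ_p = p`, `e(·,T) ≢ 1`). (Skewness of `e` / symmetry of `∪ₑ` are p04's T-2LL FILE 2b
  `TwoLagrangianLines.weilCupProduct_comm`, consumed by FILE 2 of this row — not restated here.)
* §2 `exists_isSES` — the short exact sequence `0 → ⟨T⟩ → E[p] →^{e(·,T)} μ_p → 0` of discrete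
  `Γ_F`-modules in the tree's `IsSES` currency (`⟨T⟩ = ℤT` the subrepresentation, pointwise fixed);
  `cohomologyMap_rightHom_eq_zero_iff` — **`W_T` is exactly the set of classes having a
  `⟨T⟩`-valued continuous crossed homomorphism as representative** (= r1's `ι_* H¹(F, ⟨T⟩)`; `⊆`
  is the exactness `H¹(F, ⟨T⟩) → H¹(F, E[p]) → H¹(F, μ_p)`, tree
  `IsSES.exists_map_one_eq_of_map_one_eq_zero`); `cupProduct_eq_zero_of_rightHom_eq_zero` —
  **`W_T` is ISOTROPIC** for the local Weil cup product (binder `hW`; on representatives the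
  cup-product cocycle is `e(aT, bT) = 1`); `exists_rep_zmultiples_map` — a `Γ_F`-map
  `f : E′[p] → E[p]` carries `⟨T′⟩`-represented classes to `⟨f T′⟩`-represented ones
  (`θ_* W_{T′} ≤ W_{θT′}`).

Print anchors (inputs, all tree theorems): Serre, *Galois Cohomology* I §2.2 (long exact
sequence); Neukirch–Schmidt–Wingberg (1.4.4); r1 §43.1 (iii) "`W := ι_* H¹(ℚ₃, ⟨T⟩)` … ISOTROPIC
(`e₃|⟨T⟩×⟨T⟩ = 1`)" — here for any number field, any `K`-field `F`, any prime `p`.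
-/

noncomputable section

open scoped Classical
open CategoryTheory Function Field NumberField IsDedekindDomain WeierstrassCurve
  Literature.NumberTheory.EllipticCurves Literature.NumberTheory.GaloisRepresentations
open Literature.NumberTheory.GaloisRepresentations.DiscreteGaloisModule (mu MuCarrier)
open scoped ContRepresentation

namespace Summit.BirchSwinnertonDyer.Rank1Residual.GaloisImage.ThreeLagrangianCoh

-- Cup products, `H²` and the tree's `IsSES` need `CompactSpace Γ_F`: the statements that mention
-- them carry the instance as a binder (discharged by `absoluteGaloisGroup_compactSpace F`); proofs
-- use `haveI`.  (No file-level instance attribute: kernel lane.)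

/-! ## §1 Pairing algebra on `E[p]`: the line `⟨T⟩`, the kernel and the image of `e(·, T)` -/

section PairingAlgebra

variable {K : Type} [Field K] [CharZero K] (W : WeierstrassCurve K) [W.IsElliptic]
  (p : ℕ) [hp : Fact p.Prime]
variable (e : geomTorsion W p → geomTorsion W p → AlgebraicClosure K)
  (hμ : ∀ S T, e S T ^ p = 1)
  (hadd₁ : ∀ S₁ S₂ T, e (S₁ + S₂) T = e S₁ T * e S₂ T)
  (hadd₂ : ∀ S T₁ T₂, e S (T₁ + T₂) = e S T₁ * e S T₂)

omit [CharZero K] [W.IsElliptic] in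
/-- The pairing vanishes on `⟨T⟩ × ⟨T⟩`: `w(x, y) = 0` for `x, y ∈ ℤT` (alternating `e`).
[folklore] -/
theorem weilPairingHom_eq_zero_of_mem_zmultiples (halt : ∀ T, e T T = 1) (T : geomTorsion W p)
    {x y : geomTorsion W p} (hx : x ∈ AddSubgroup.zmultiples T)
    (hy : y ∈ AddSubgroup.zmultiples T) : weilPairingHom W p e hμ hadd₁ hadd₂ x y = 0 := by
  obtain ⟨a, rfl⟩ := AddSubgroup.mem_zmultiples_iff.mp hx
  obtain ⟨b, rfl⟩ := AddSubgroup.mem_zmultiples_iff.mp hy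
  simp only [map_zsmul, AddMonoidHom.zsmul_apply, weilPairingHom_self W p e hμ hadd₁ hadd₂ halt T,
    smul_zero]

omit [CharZero K] [W.IsElliptic] hp in
/-- Elements of `E[p]` are killed by `p`. [folklore] -/
theorem nsmul_geomTorsion_eq_zero (T : geomTorsion W p) : p • T = 0 := by
  apply Subtype.ext
  rw [AddSubmonoidClass.coe_nsmul, ZeroMemClass.coe_zero, ← natCast_zsmul]
  exact (Submodule.mem_torsionBy_iff _ _).mp T.2

omit [CharZero K] [W.IsElliptic] in
/-- `#ℤT = p` for a non-zero `T ∈ E[p]`. [folklore] -/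
theorem natCard_zmultiples_eq (T : geomTorsion W p) (hT0 : T ≠ 0) :
    Nat.card (AddSubgroup.zmultiples T) = p := by
  rw [Nat.card_zmultiples]
  have hpT : p • T = 0 := nsmul_geomTorsion_eq_zero W p T
  exact ((Nat.dvd_prime hp.out).mp (addOrderOf_dvd_of_nsmul_eq_zero hpT)).resolve_left
    (fun h1 ↦ hT0 (AddMonoid.addOrderOf_eq_one_iff.mp h1))

/-- **`ker e(·, T) = ⟨T⟩` and `e(·, T)` is onto `μ_p`** for a non-zero `T ∈ E[p]` and a
non-degenerate alternating `e`: the homomorphism `S ↦ w(S, T)`, `E[p] → μ_p`, is non-zero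
(non-degeneracy), so by counting (`#E[p] = p²`, `#μ_p = p`, `⟨T⟩ ≤ ker`) its kernel is `⟨T⟩` and
it is surjective. [folklore] -/
theorem ker_weilPairingHom_flip_eq_and_surjective (halt : ∀ T, e T T = 1)
    (hnondeg : ∀ T, (∀ S, e S T = 1) → T = 0) (T : geomTorsion W p) (hT0 : T ≠ 0) :
    ((weilPairingHom W p e hμ hadd₁ hadd₂).flip T).ker = AddSubgroup.zmultiples T ∧
      Surjective ((weilPairingHom W p e hμ hadd₁ hadd₂).flip T) := by
  set χ := (weilPairingHom W p e hμ hadd₁ hadd₂).flip T with hχ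
  have hχapp : ∀ S, χ S = weilPairingHom W p e hμ hadd₁ hadd₂ S T := fun S ↦ rfl
  have hpp := hp.out
  -- `⟨T⟩ ≤ ker χ`
  have hle : AddSubgroup.zmultiples T ≤ χ.ker := by
    intro x hx
    rw [AddMonoidHom.mem_ker, hχapp]
    exact weilPairingHom_eq_zero_of_mem_zmultiples W p e hμ hadd₁ hadd₂ halt T hx
      (AddSubgroup.mem_zmultiples T)
  -- `χ ≠ 0`
  have hne : χ.range ≠ ⊥ := by
    intro hbot
    apply hT0
    refine hnondeg T fun S ↦ ?_
    have hS : χ S = 0 := by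
      have hmem : χ S ∈ χ.range := ⟨S, rfl⟩
      rw [hbot] at hmem
      exact (AddSubgroup.mem_bot).mp hmem
    rw [hχapp, muCarrier_eq_iff, coe_weilPairingHom] at hS
    exact hS
  -- counting
  have hM : Nat.card (geomTorsion W p) = p ^ 2 := by
    rw [natCard_geomTorsion W (p : ℤ) (by exact_mod_cast hpp.ne_zero), Int.natAbs_natCast]
  have hμcard : Nat.card (MuCarrier K p) = p := natCard_muCarrier K p
  haveI : Finite (MuCarrier K p) := Nat.finite_of_card_ne_zero (by rw [hμcard]; exact hpp.ne_zero)
  haveI : Finite (geomTorsion W p) := finite_geomTorsion_of_neZero W p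
  have hrange_dvd : Nat.card χ.range ∣ p := by
    have h := AddSubgroup.card_addSubgroup_dvd_card χ.range
    rwa [hμcard] at h
  have hrange : Nat.card χ.range = p := by
    rcases (Nat.dvd_prime hpp).mp hrange_dvd with h1 | h2
    · exact absurd (AddSubgroup.eq_bot_of_card_eq χ.range h1) hne
    · exact h2
  have hker_mul : Nat.card χ.ker * Nat.card χ.range = p ^ 2 := by
    rw [← hM, ← Nat.card_congr (QuotientAddGroup.quotientKerEquivRange χ).toEquiv, mul_comm]
    exact (AddSubgroup.card_eq_card_quotient_mul_card_addSubgroup χ.ker).symm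
  have hker : Nat.card χ.ker = p := by
    rw [hrange, sq] at hker_mul
    exact Nat.eq_of_mul_eq_mul_right hpp.pos hker_mul
  refine ⟨(AddSubgroup.eq_of_le_of_card_ge hle ?_).symm, ?_⟩
  · rw [hker, natCard_zmultiples_eq W p T hT0]
  · rw [← AddMonoidHom.range_eq_top]
    exact AddSubgroup.eq_top_of_card_eq χ.range (by rw [hrange, hμcard])

end PairingAlgebra

/-! ## §2 `W_T = ker H¹(e(·,T))`: the short exact sequence, the cocycle description, isotropy, transport -/

section Kernel

variable {K : Type} [Field K] [NumberField K] (W : WeierstrassCurve K) [W.IsElliptic]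
  (p : ℕ) [hp : Fact p.Prime]
variable (e : geomTorsion W p → geomTorsion W p → AlgebraicClosure K)
  (hμ : ∀ S T, e S T ^ p = 1)
  (hadd₁ : ∀ S₁ S₂ T, e (S₁ + S₂) T = e S₁ T * e S₂ T)
  (hadd₂ : ∀ S T₁ T₂, e S (T₁ + T₂) = e S T₁ * e S T₂)
  (hgal : ∀ (σ : absoluteGaloisGroup K) (S T : geomTorsion W p), σ • e S T = e (σ • S) (σ • T))
variable (F : Type) [Field F] [Algebra K F]

/-- **The short exact sequence `0 → ⟨T⟩ → E[p] →^{e(·,T)} μ_p → 0` of discrete `Γ_F`-modules**,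
for `T ≠ 0` fixed by `Γ_F` and `e` a Weil pairing: `⟨T⟩ = ℤT` is the `Γ_F`-stable (indeed
pointwise fixed) subrepresentation, the middle exactness is `ker e(·,T) = ⟨T⟩` and the right
surjectivity is `e(·,T)(E[p]) = μ_p` (`ker_weilPairingHom_flip_eq_and_surjective`), in the tree's
`IsSES` currency (so that its long exact sequence applies). [folklore] -/
theorem exists_isSES [CompactSpace (absoluteGaloisGroup F)] (halt : ∀ T, e T T = 1)
    (hnondeg : ∀ T, (∀ S, e S T = 1) → T = 0)
    (T : geomTorsion W p) (hT : ∀ σ : absoluteGaloisGroup F, absGaloisRestrict K F σ • T = T)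
    (hT0 : T ≠ 0) :
    ∃ (ρ₁ : ContinuousRep (absoluteGaloisGroup F) ℤ ((AddSubgroup.zmultiples T).toIntSubmodule))
      (f : ρ₁.toTopRep ⟶ (GaloisRep.restrictField F (W.torsionGaloisModule p)).toTopRep),
      IsSES (ρ₂ := GaloisRep.restrictField F (W.torsionGaloisModule p))
        (ρ₃ := GaloisRep.restrictField F (mu K p)) f
        (((weilContPairing W p e hμ hadd₁ hadd₂ hgal).restrict (absGaloisRestrict K F)).rightHom T hT) ∧
      (∀ c, f.hom c = (c : geomTorsion W p)) ∧ (∀ σ c, ρ₁ σ c = c) := by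
  let Γ := absoluteGaloisGroup F
  let ρ₂ : ContinuousRep Γ ℤ (geomTorsion W p) := GaloisRep.restrictField F (W.torsionGaloisModule p)
  let C : Submodule ℤ (geomTorsion W p) := (AddSubgroup.zmultiples T).toIntSubmodule
  have hmemC : ∀ x, x ∈ C ↔ x ∈ AddSubgroup.zmultiples T := fun x ↦ Iff.rfl
  have hTfix : ∀ σ : Γ, ρ₂ σ T = T := fun σ ↦ hT σ
  have hCfix : ∀ (σ : Γ) (c : geomTorsion W p), c ∈ C → ρ₂ σ c = c := by
    intro σ c hc
    obtain ⟨a, rfl⟩ := AddSubgroup.mem_zmultiples_iff.mp ((hmemC c).mp hc)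
    rw [map_zsmul, hTfix]
  have hstab : ∀ σ : Γ, C ≤ C.comap (ρ₂ σ) := fun σ c hc ↦ by
    rw [Submodule.mem_comap, hCfix σ c hc]; exact hc
  let ρ₁ : ContinuousRep Γ ℤ C := ρ₂.subrepresentation C hstab
  have hρ₁ : ∀ (σ : Γ) (c : C), ρ₁ σ c = c := fun σ c ↦
    Subtype.ext ((ContinuousRep.subrepresentation_apply_coe ρ₂ C hstab σ c).trans (hCfix σ c c.2))
  let f : ρ₁.toTopRep ⟶ ρ₂.toTopRep :=
    TopRep.ofHom (X := ρ₁.toTopRep) (Y := ρ₂.toTopRep)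
      ⟨⟨C.subtype, continuous_subtype_val⟩, fun σ ↦ ContinuousLinearMap.ext fun c ↦ rfl⟩
  have hf : ∀ c, f.hom c = (c : geomTorsion W p) := fun _ ↦ rfl
  let P := (weilContPairing W p e hμ hadd₁ hadd₂ hgal).restrict (absGaloisRestrict K F)
  let g : ρ₂.toTopRep ⟶ (GaloisRep.restrictField F (mu K p)).toTopRep := P.rightHom T hT
  have hg : ∀ S, g.hom S = weilPairingHom W p e hμ hadd₁ hadd₂ S T := fun S ↦ rfl
  have hker := ker_weilPairingHom_flip_eq_and_surjective W p e hμ hadd₁ hadd₂ halt hnondeg T hT0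
  refine ⟨ρ₁, f, ⟨?_, ?_, ?_, ?_⟩, hf, hρ₁⟩
  · -- `f ≫ g = 0`: `e(c, T) = 1` on `⟨T⟩`
    ext c
    change g.hom (f.hom c) = 0
    rw [hf, hg]
    exact weilPairingHom_eq_zero_of_mem_zmultiples W p e hμ hadd₁ hadd₂ halt T c.2
      (AddSubgroup.mem_zmultiples T)
  · exact Subtype.val_injective
  · -- `ker e(·,T) = ⟨T⟩`
    intro y hy
    rw [hg] at hy
    have hmem : y ∈ AddSubgroup.zmultiples T := by
      rw [← hker.1]; exact hy
    exact ⟨⟨y, hmem⟩, rfl⟩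
  · -- `e(·,T)` is onto `μ_p`
    intro ζ
    obtain ⟨S, hS⟩ := hker.2 ζ
    exact ⟨S, hS⟩

omit [NumberField K] [W.IsElliptic] in
/-- **`W_T ⊇ {classes with a ⟨T⟩-valued representative}`**: if the continuous crossed
homomorphism `φ : Γ_F → E[p]` takes values in `ℤT`, then `H¹(e(·,T)) [φ] = 0` (the cocycle
`σ ↦ e(φ σ, T)` is identically `1`). Needs only `e` alternating. [folklore] -/
theorem cohomologyMap_rightHom_eq_zero_of_forall_mem_zmultiples (halt : ∀ T, e T T = 1)
    (T : geomTorsion W p) (hT : ∀ σ : absoluteGaloisGroup F, absGaloisRestrict K F σ • T = T)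
    (φ : contOneCocycles (GaloisRep.restrictField F (W.torsionGaloisModule p)).toTopRep)
    (hφ : ∀ σ, φ.1 σ ∈ AddSubgroup.zmultiples T) :
    cohomologyMap (((weilContPairing W p e hμ hadd₁ hadd₂ hgal).restrict
      (absGaloisRestrict K F)).rightHom T hT) 1
        (oneCocycleClass (GaloisRep.restrictField F (W.torsionGaloisModule p)).toTopRep φ) = 0 := by
  refine (cohomologyMap_oneCocycleClass _ φ).trans ?_
  rw [oneCocycleClass_eq_zero_iff]
  refine ⟨0, fun σ ↦ ?_⟩
  rw [pullback_id_resIdHom_apply, map_zero, sub_zero]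
  change weilPairingHom W p e hμ hadd₁ hadd₂ (φ.1 σ) T = 0
  exact weilPairingHom_eq_zero_of_mem_zmultiples W p e hμ hadd₁ hadd₂ halt T (hφ σ)
    (AddSubgroup.mem_zmultiples T)

/-- **`W_T = {classes with a ⟨T⟩-valued representative}`** (`= ι_* H¹(F, ⟨T⟩)`, r1 §43.1 (iii)):
for `T ≠ 0` fixed by `Γ_F` and `e` a Weil pairing (alternating, non-degenerate, equivariant),
`H¹(e(·,T)) x = 0 ↔ ∃ φ, [φ] = x ∧ ∀ σ, φ σ ∈ ℤT`. The direction `→` is the exactness of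
`H¹(F, ⟨T⟩) → H¹(F, E[p]) → H¹(F, μ_p)` (tree `IsSES.exists_map_one_eq_of_map_one_eq_zero`) for the
short exact sequence `exists_isSES`. [cite: SerreGaloisCohomology1997, I §2.2] -/
theorem cohomologyMap_rightHom_eq_zero_iff (halt : ∀ T, e T T = 1)
    (hnondeg : ∀ T, (∀ S, e S T = 1) → T = 0)
    (T : geomTorsion W p) (hT : ∀ σ : absoluteGaloisGroup F, absGaloisRestrict K F σ • T = T)
    (hT0 : T ≠ 0) (x : galoisCohomology (GaloisRep.restrictField F (W.torsionGaloisModule p)) 1) :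
    cohomologyMap (((weilContPairing W p e hμ hadd₁ hadd₂ hgal).restrict
      (absGaloisRestrict K F)).rightHom T hT) 1 x = 0 ↔
      ∃ φ : contOneCocycles (GaloisRep.restrictField F (W.torsionGaloisModule p)).toTopRep,
        oneCocycleClass _ φ = x ∧ ∀ σ, φ.1 σ ∈ AddSubgroup.zmultiples T := by
  refine ⟨fun hx ↦ ?_, ?_⟩
  swap
  · rintro ⟨φ, rfl, hφ⟩
    exact cohomologyMap_rightHom_eq_zero_of_forall_mem_zmultiples W p e hμ hadd₁ hadd₂ hgal F halt
      T hT φ hφ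
  haveI := absoluteGaloisGroup_compactSpace F
  obtain ⟨ρ₁, f, hses, hf, -⟩ := exists_isSES W p e hμ hadd₁ hadd₂ hgal F halt hnondeg T hT hT0
  obtain ⟨z, hz⟩ := hses.exists_map_one_eq_of_map_one_eq_zero x hx
  obtain ⟨ψ, rfl⟩ := oneCocycleClass_surjective _ z
  refine ⟨contOneCocycles.pullback (ContinuousMonoidHom.id _) (resIdHom f) ψ, ?_, fun σ ↦ ?_⟩
  · rw [← cohomologyMap_oneCocycleClass]
    exact hz
  · rw [pullback_id_resIdHom_apply, hf]
    exact (ψ.1 σ).2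

/-- **`W_T` is ISOTROPIC for the local Weil cup product** (binder `hW` of p02's F3): if
`H¹(e(·,T)) x = 0 = H¹(e(·,T)) y` then `x ∪ₑ y = 0` in `H²(Γ_F, μ_p)`. On `⟨T⟩`-valued
representatives `φ, ψ` (`cohomologyMap_rightHom_eq_zero_iff`) the cup-product cocycle
`(σ, τ) ↦ e(φ σ, ψ(στ) − ψ σ)` is identically `1` (`e|⟨T⟩×⟨T⟩ = 1`). r1 §43.1 (iii) "ISOTROPIC
(`e₃|⟨T⟩×⟨T⟩ = 1`)". [cite: NeukirchSchmidtWingberg2008, I §4 (1.4.4)] -/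
theorem cupProduct_eq_zero_of_rightHom_eq_zero [CompactSpace (absoluteGaloisGroup F)]
    (halt : ∀ T, e T T = 1)
    (hnondeg : ∀ T, (∀ S, e S T = 1) → T = 0)
    (T : geomTorsion W p) (hT : ∀ σ : absoluteGaloisGroup F, absGaloisRestrict K F σ • T = T)
    (hT0 : T ≠ 0) {x y : galoisCohomology (GaloisRep.restrictField F (W.torsionGaloisModule p)) 1}
    (hx : cohomologyMap (((weilContPairing W p e hμ hadd₁ hadd₂ hgal).restrict
      (absGaloisRestrict K F)).rightHom T hT) 1 x = 0)
    (hy : cohomologyMap (((weilContPairing W p e hμ hadd₁ hadd₂ hgal).restrict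
      (absGaloisRestrict K F)).rightHom T hT) 1 y = 0) :
    ((weilContPairing W p e hμ hadd₁ hadd₂ hgal).restrict (absGaloisRestrict K F)).cupProduct x y
      = 0 := by
  obtain ⟨φ, rfl, hφ⟩ := (cohomologyMap_rightHom_eq_zero_iff W p e hμ hadd₁ hadd₂ hgal F halt hnondeg
    T hT hT0 x).mp hx
  obtain ⟨ψ, rfl, hψ⟩ := (cohomologyMap_rightHom_eq_zero_iff W p e hμ hadd₁ hadd₂ hgal F halt hnondeg
    T hT hT0 y).mp hy
  refine (ContPairing.cupProduct_oneCocycleClass_eq_twoCocycleClass _ φ ψ).trans ?_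
  rw [← twoCocycleClass_zero]
  congr 1
  refine Subtype.ext (ContinuousMap.ext fun q ↦ ?_)
  obtain ⟨σ, τ⟩ := q
  rw [ContPairing.cupCocycle_apply, ContPairing.restrict_toLin, weilContPairing_toLin_apply]
  exact weilPairingHom_eq_zero_of_mem_zmultiples W p e hμ hadd₁ hadd₂ halt T (hφ σ)
    (sub_mem (hψ (σ * τ)) (hψ σ))

omit [NumberField K] [W.IsElliptic] hp in
/-- **Transport of `⟨T⟩`-represented classes along a `Γ_F`-map**: for a continuous
`Γ_F`-equivariant `f : E′[p] → E[p]` (e.g. the restriction of a `p`-congruence `θ`), a class of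
`H¹(F, E′[p])` represented by a `⟨T′⟩`-valued crossed homomorphism is carried by `H¹(f)` to a class
represented by an `⟨f T′⟩`-valued one — with `cohomologyMap_rightHom_eq_zero_iff`:
`θ_* W_{T′} ≤ W_{θ T′}` (and `=` for an isomorphism). [folklore] -/
theorem exists_rep_zmultiples_map (W' : WeierstrassCurve K) [W'.IsElliptic]
    (f : (GaloisRep.restrictField F (W'.torsionGaloisModule (p : ℤ))).toContRepresentation →ⁱL
      (GaloisRep.restrictField F (W.torsionGaloisModule (p : ℤ))).toContRepresentation)
    (T' : geomTorsion W' p) {x : galoisCohomology (GaloisRep.restrictField F (W'.torsionGaloisModule p)) 1}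
    (hx : ∃ φ : contOneCocycles (GaloisRep.restrictField F (W'.torsionGaloisModule p)).toTopRep,
        oneCocycleClass _ φ = x ∧ ∀ σ, φ.1 σ ∈ AddSubgroup.zmultiples T') :
    ∃ φ : contOneCocycles (GaloisRep.restrictField F (W.torsionGaloisModule p)).toTopRep,
        oneCocycleClass _ φ = galoisCohomology.map f 1 x ∧ ∀ σ, φ.1 σ ∈ AddSubgroup.zmultiples (f T') := by
  obtain ⟨φ, rfl, hφ⟩ := hx
  refine ⟨_, (galoisCohomology.map_one_oneCocycleClass f φ).symm, fun σ ↦ ?_⟩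
  rw [contOneCocycles.pullback_apply]
  change f (φ.1 σ) ∈ AddSubgroup.zmultiples (f T')
  obtain ⟨a, ha⟩ := AddSubgroup.mem_zmultiples_iff.mp (hφ σ)
  rw [← ha, map_zsmul]
  exact AddSubgroup.zsmul_mem_zmultiples (f T') a

end Kernel


end Summit.BirchSwinnertonDyer.Rank1Residual.GaloisImage.ThreeLagrangianCoh

end
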